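import Literature.IUT.HodgeArakelov.ThetaEvaluationModelEv
import Literature.IUT.HodgeArakelov.CohomologyLimitKummer

/-!
# The inflation section carries the Kummer class of a constant on `D` to its Kummer class on `H`
# ([IUTchII] Cor. 1.12 (c): "the natural inclusion of `M^×_TM(Π)` into the inductive limit of the first line"
# IS the Kummer map) — proof companion

Proof-only companion (abc-iut cell, D-0067 wave 4, seat abc-iut-w4-d043 gen 2; L6-lead ruling §F v1.18c (1); SUBDAG
`plan/L6/SUBDAG-IUTchII-Cor-112.md` rows Cor-112.0.r1 / Cor-112.ii.r13) to `ThetaEvaluationModelEv.lean` (the inflation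
section `LevelRetraction.h1LimSection`, p417475) and to abc-iut-w4-d007's `CohomologyLimitKummer.lean` (the Kummer map
`h1LimKummer` of a discrete rootable `Π`-module into the genuine limit `lim_K H¹(H|_K, A')`, p416543). No definitions.

S. Mochizuki, *Inter-universal Teichmüller theory II*, kurims manuscript (Dec. 2020), Cor. 1.12 p. 56 (c), verbatim
(ll. 25–29): "we recall that it follows from the definitions [cf. Example 1.8, (ii), (iii); [AbsTopIII], Definition 3.1,
(vi); [IUTchI], Remark 3.1.2] that one has a natural inclusion `M^×_TM(Π) ↪ lim_J H¹(J, (l·Δ_Θ)(Π))`, hence a natural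
inclusion of `M^×_TM(Π)` into the inductive limit of the first line".  GLOSS (ours, NOT print's wording — doc-only repair
of referee lane O PASS O9 item 4, defect O9-F5): in the tree this inclusion is READ as the Kummer map of the unit monoid
with its coefficients changed along the cyclotomic rigidity isomorphism `μ_Ẑ(G_k) ⥲ (l·Δ_Θ)(Π)` of Corollary 1.11 (a)
(kurims p. 49) — abc-iut-w4-d007's `h1LimKummer … c`.  Claim key `Mochizuki2012` (D-0012, DISPUTED); classical Kummer
theory [cite: NeukirchSchmidtWingberg2008, I §5]; nothing here takes a side on [IUTchIII] Cor. 3.12.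

PROVED. If the `Π`-module `A` (the model: `k̄ˣ`) is acted on THROUGH the retractions — `ψ_K(k)` and `k` act
identically on `A` (`hψA`; at the model `Ker(Π ↠ G_k)` acts trivially on `k̄`) — then
* `retractH1_kummerContClass` — the pull-back along a retraction `ψ : K → L` of the continuous Kummer class of
  `b` on `L` is the continuous Kummer class of `b` on `K` (the Kummer cocycle `h ↦ c((h·β_n/β_n)_n)` only sees the
  action on the roots);
* **`LevelRetraction.h1LimSection_h1LimKummer`** — the inflation section carries `κ_D(b) ∈ lim_K H¹(D|_K, A')` to
  `κ_H(b) ∈ lim_K H¹(H|_K, A')`: `R.h1LimSection (κ_D b) = κ_H b`;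
* `LevelRetraction.h1LimSection_image_kummer` — hence the image under the section of the `D`-Kummer image of any
  subgroup `U ≤ A` (the units `O^×`) is the `H`-Kummer image of `U`: print's "natural inclusion of `M^×_TM(Π)` into
  the inductive limit of the first line" is literally the Kummer map of abc-iut-w4-d007 at `H = Π_Ÿ(Π)`.
Consequently the input `(hι)` of Cor. 1.12 (ii) for the model datum reads "`ι` fixes the `Π_Ÿ`-level Kummer classes of
the units up to torsion". Typed ≠ discharged.
-/

noncomputable section

namespace Literature.IUT.HodgeArakelov

open Literature.AnabelianGeometry.EtaleTheta CohomologySystemOfContH1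

namespace CohomologySystemOfContH1

variable {P : TopGroup.{0}} {G' : Type} [Group G'] [TopologicalSpace G'] [IsTopologicalGroup G']
  (φ : P →* G') (A' : Subgroup G') [A'.Normal] [IsMulCommutative A']
  {A : Type} [CommGroup A] [MulDistribMulAction P A] [TopologicalSpace A]
  (c : CyclotomeCoefficients φ A' A)

/-- The pull-back along a retraction `ψ : K → L` (with `ψ k` and `k` acting identically on the coefficients AND on
the module `A`) of the continuous Kummer class of `b` on `L` is the continuous Kummer class of `b` on `K`: the
Kummer cocycle `h ↦ c((h·β_n/β_n)_n)` depends on `h` only through its action on the roots `β_n`.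
[cite: NeukirchSchmidtWingberg2008, I §5] -/
theorem retractH1_kummerContClass {K L : Subgroup P} (ψ : K →* L) (hψc : Continuous ψ)
    (hψ : ∀ (k : K) (a : A'), MulAut.conjNormal (φ ((ψ k : L) : P)) a = MulAut.conjNormal (φ (k : P)) a)
    (hψA : ∀ (k : K) (b : A), ((ψ k : L) : P) • b = (k : P) • b)
    {b : A} (x : RootSystem b) (hbL : b ∈ MulAction.fixedPoints L A) (hbK : b ∈ MulAction.fixedPoints K A)
    (hx : ∀ n : ℕ+, IsOpen (MulAction.stabilizer P (x.root n) : Set P)) :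
    retractH1 φ A' ψ hψc hψ (c.kummerContClass L x hbL hx) = c.kummerContClass K x hbK hx := by
  change QuotientGroup.mk (retractCocycle φ A' ψ hψc hψ (c.kummerContCocycle L x hbL hx)) =
    QuotientGroup.mk (c.kummerContCocycle K x hbK hx)
  congr 1
  apply Subtype.ext
  funext k
  change c.hom (x.kummerCocycle hbL (ψ k)) = c.hom (x.kummerCocycle hbK k)
  congr 1
  apply Subtype.ext
  funext n
  change ((ψ k : L) : P) • x.root n / x.root n = (k : P) • x.root n / x.root n
  rw [hψA]

variable (hA : ∀ b : A, IsOpen (MulAction.stabilizer P b : Set P)) [RootableBy A ℕ]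
  (hfi : ∀ b : A, (MulAction.stabilizer P b).FiniteIndex)

namespace LevelRetraction

variable {φ A'} {H D : Subgroup P} (R : LevelRetraction φ A' H D)

omit [TopologicalSpace G'] [IsTopologicalGroup G'] [IsMulCommutative A'] [TopologicalSpace A] [RootableBy A ℕ] in
/-- If `ψ_K(k)` and `k` act identically on `A` then an element fixed by `D ∩ K` is fixed by `H ∩ lift K`.
[cite: NeukirchSchmidtWingberg2008, I §5] -/
theorem mem_fixedPoints_lift (hψA : ∀ i (k : ↥(H ⊓ (R.lift i).K)) (b : A),
      ((R.ψ i k : ↥(D ⊓ i.K)) : P) • b = (k : P) • b)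
    (i : Idx (P := P) ⊥) {b : A} (hb : b ∈ MulAction.fixedPoints ↥(D ⊓ i.K) A) :
    b ∈ MulAction.fixedPoints ↥(H ⊓ (R.lift i).K) A := fun k => by
  change (k : P) • b = b
  rw [← hψA i k b]
  exact hb (R.ψ i k)

/-- The member section carries the level-`K` Kummer class on `D` to the level-`lift K` Kummer class on `H`.
[cite: Mochizuki2012, Cor 1.12 (c) p.56] -/
theorem sectionGmod_kummerGmod (hψA : ∀ i (k : ↥(H ⊓ (R.lift i).K)) (b : A),
      ((R.ψ i k : ↥(D ⊓ i.K)) : P) • b = (k : P) • b)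
    (i : Idx (P := P) ⊥) (b : A) (hb : b ∈ MulAction.fixedPoints ↥(D ⊓ i.K) A) :
    R.sectionGmod i (kummerGmod φ A' D c hA i b hb) =
      kummerGmod φ A' H c hA (R.lift i) b (R.mem_fixedPoints_lift hψA i hb) := by
  rw [kummerGmod_eq_of_rootSystem φ A' D c hA i b hb (RootSystem.ofRootableBy b),
    kummerGmod_eq_of_rootSystem φ A' H c hA (R.lift i) b (R.mem_fixedPoints_lift hψA i hb)
      (RootSystem.ofRootableBy b)]
  exact congrArg Additive.ofMul
    (retractH1_kummerContClass φ A' c (R.ψ i) (R.ψ_continuous i) (R.ψ_act i) (hψA i)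
      (RootSystem.ofRootableBy b) hb (R.mem_fixedPoints_lift hψA i hb) fun _ => hA _)

/-- **The inflation section carries the Kummer class of `b` on `D` to the Kummer class of `b` on `H`**:
`R.h1LimSection (κ_D b) = κ_H b` in `lim_K H¹(H|_K, A')` — "the natural inclusion of `M^×_TM(Π)` into the
inductive limit of the first line" (Cor. 1.12 (c)) IS abc-iut-w4-d007's Kummer map at `H`.
[cite: Mochizuki2012, Cor 1.12 (c) p.56] -/
theorem h1LimSection_h1LimKummer (hψA : ∀ i (k : ↥(H ⊓ (R.lift i).K)) (b : A),
      ((R.ψ i k : ↥(D ⊓ i.K)) : P) • b = (k : P) • b) (b : A) :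
    R.h1LimSection (Multiplicative.toAdd (h1LimKummer φ A' D c hA hfi b)) =
      Multiplicative.toAdd (h1LimKummer φ A' H c hA hfi b) := by
  rw [h1LimKummer_eq_h1Of φ A' D c hA hfi b (stabIdx hA hfi b) (mem_fixedPoints_stabIdx D hA hfi b),
    h1LimKummer_eq_h1Of φ A' H c hA hfi b (R.lift (stabIdx hA hfi b))
      (R.mem_fixedPoints_lift hψA _ (mem_fixedPoints_stabIdx D hA hfi b)),
    toAdd_ofAdd, toAdd_ofAdd, h1LimSection_of, R.sectionGmod_kummerGmod c hA hψA]

/-- Hence, for any subgroup `U ≤ A` (the units `O^×_{k̄}`): the image under the inflation section of the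
`D`-Kummer image of `U` is the `H`-Kummer image of `U` — the unit classes `M^×_TM(Π)` of the model datum sit in the
first line `lim_J H¹(Π_Ÿ(Π)|_J, ·)` as the Kummer classes of the units. [cite: Mochizuki2012, Cor 1.12 (c) p.56] -/
theorem h1LimSection_image_kummer (hψA : ∀ i (k : ↥(H ⊓ (R.lift i).K)) (b : A),
      ((R.ψ i k : ↥(D ⊓ i.K)) : P) • b = (k : P) • b) (U : Subgroup A) :
    R.h1LimSection '' (AddSubgroup.toSubgroup.symm (U.map (h1LimKummer φ A' D c hA hfi)) : Set (h1Lim φ A' D ⊥)) =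
      (AddSubgroup.toSubgroup.symm (U.map (h1LimKummer φ A' H c hA hfi)) : Set (h1Lim φ A' H ⊥)) := by
  ext y
  constructor
  · rintro ⟨z, hz, rfl⟩
    obtain ⟨u, hu, huz⟩ := Subgroup.mem_map.mp hz
    refine Subgroup.mem_map.mpr ⟨u, hu, ?_⟩
    change h1LimKummer φ A' H c hA hfi u = Multiplicative.ofAdd (R.h1LimSection z)
    have hz' : z = Multiplicative.toAdd (h1LimKummer φ A' D c hA hfi u) := by
      rw [huz]; rfl
    rw [hz', R.h1LimSection_h1LimKummer c hA hfi hψA u]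
    rfl
  · intro hy
    obtain ⟨u, hu, huy⟩ := Subgroup.mem_map.mp hy
    refine ⟨Multiplicative.toAdd (h1LimKummer φ A' D c hA hfi u), ?_, ?_⟩
    · exact Subgroup.mem_map.mpr ⟨u, hu, rfl⟩
    · rw [R.h1LimSection_h1LimKummer c hA hfi hψA u, huy]
      rfl

end LevelRetraction

omit [TopologicalSpace A] [RootableBy A ℕ] in
/-- For the canonical retractions of an augmentation `q` (any `ψ` with `q (ψ k) = q k`): if the `Π`-action on `A`
FACTORS THROUGH `q` (`Ker(q)` acts trivially on `A`; at the model `Δ^tp_{X̲̲}` acts trivially on `k̄`), then `ψ k` and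
`k` act identically on `A` (the hypothesis `hψA` above). [cite: NeukirchSchmidtWingberg2008, I §5] -/
theorem smul_eq_of_q_eq {Q : Type} [Group Q] (q : P →* Q) (hNA : ∀ n : P, q n = 1 → ∀ b : A, n • b = b)
    {g h : P} (hq : q g = q h) (b : A) : g • b = h • b := by
  have hn : q (h * g⁻¹) = 1 := by rw [map_mul, map_inv, hq, mul_inv_cancel]
  have key := hNA _ hn (g • b)
  rw [mul_smul, inv_smul_smul] at key
  exact key.symm ▸ rfl

end CohomologySystemOfContH1

end Literature.IUT.HodgeArakelov
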